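import Summits.HubbardSuperconductivity.HubbardSuperconductivity.Theorems.BalabanIRBirComplexStableXYStiffnessHolomorphy
import Summits.HubbardSuperconductivity.HubbardSuperconductivity.Theorems.BalabanIRBirComplexStableXYStiffnessAdmissible
import Summits.HubbardSuperconductivity.HubbardSuperconductivity.Theorems.BirComplexStableXY.Negative.BirComplexStableXYFalseOfStiffTwoLevelStructure
import Summits.HubbardSuperconductivity.HubbardSuperconductivity.Theorems.BalabanIRBirComplexStableXYPartZApriori
import Literature.Analysis.Complex.ZeroFreeGrowthRigidity

/-!
# Negative lemma for `BalabanIR.BirComplexStableXY` (stmt-HubbardSuperconductivity-2080) modulo `StiffModulusCrossing`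

Prover seat c3-0 on the glue item stmt-HubbardSuperconductivity-2082 (`BirGappedPhaseReduction :=
BirComplexStableXY → BirGroundStateAverageLRO`, decided by this negative lane), 2026-08-16.

The Beraha–Kahane–Weiss refutation of the typed engine, CLOSED MODULO A WEAKER SPECTRAL HEART than the
two-level structure of `BirComplexStableXYFalseOfStiffTwoLevelStructure.lean`.  Same admissible family: the
stiffness table `c(a, ε₂) = spatialTab + a • temporalCosTab + (iε₂) • temporalSinTab` (admissible for the crux with
`r = 2`, `B = 128`, `c₀ = 1/24` on `‖a − 1‖ ≤ 1/4`, `|ε₂| ≤ 1/5`: `stub_stiffTab_admissible`; `Z` entire in `a`: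
`stub_partZ_stiff_differentiable`).

* `StiffModulusCrossing` (hypothesis H''): for every `K₀, L₀` there are `K ≥ K₀`, `L ≥ L₀`, `|ε₂| ≤ 1/5`, a ball
  `closedBall a₀ ρ ⊆ closedBall 1 (1/4)` of complex temporal stiffnesses, a holomorphic normaliser `lam` with
  `‖lam‖ ≥ m > 0` on the ball, DOMINANCE `‖Z_M(a)/lam(a)^M − 1‖ ≤ 1/2` on a sub-ball for all large `M`, and CROSSING
  at one point `a₁` of the ball, `e^{ηM} ‖lam a₁‖^M ≤ ‖Z_M(a₁)‖` along a subsequence.  Intended reading: `lam` = Kato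
  branch of the dominant charge-sector eigenvalue of the slice transfer operator at `a₀`; at `a₁` another sector's
  eigenvalue has larger modulus.  NO analysis at the modulus tie is asked (no two-level normal form, no geometric
  remainder, no non-constancy of the eigenvalue ratio) — `stiffModulusCrossing_of_stiffTwoLevelStructure` shows H''
  is implied by the older heart, so `BirComplexStableXY_false_of_StiffModulusCrossing` subsumes
  `BirComplexStableXY_false_of_StiffTwoLevelStructure` (`…'` below re-derives it).
* `BirComplexStableXY_false_of_StiffModulusCrossing : StiffModulusCrossing → ¬ BirComplexStableXY`: conjunct 1 of the
  crux makes `f_M := Z_M/lam^M` zero-free and holomorphic on the ball for `M ≥ L`; the a-priori bound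
  `‖Z_M‖ ≤ exp(M·|(ℤ/L)²|·(128|K| + log 2π))` (`norm_partZ_le_exp`) gives `‖f_M‖ ≤ e^{C M}`; the Literature lemma
  `Literature.Analysis.Complex.not_frequently_exp_mul_le_norm_of_zeroFree` (zero-free holomorphic families cannot
  change their exponential growth rate inside a ball: holomorphic logarithm, Borel–Carathéodory, Hadamard three
  circles — the quantitative Vitali form of the BKW necessity argument) contradicts the crossing.

What H'' still needs (not constructible in the tree today): the charge-sector trace formula for the slice transfer
operator, a simple dominant eigenvalue at two admissible stiffness points (Jentzsch per sector for real stiffness,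
Kato continuation), and the tie of the sector-0 / sector-1 tops tuned by the real Berry parameter `ε₂` and crossed
by varying `Re a` inside a ball of radius `< 1/4`.
-/

namespace Summit.HubbardSuperconductivity.BirComplexStableXYNegative

open scoped BigOperators Topology
open MeasureTheory Metric Filter Literature.Probability.LatticeModels

noncomputable section

/-! ### Hypothesis H'' (modulus crossing) and the negative lemma -/

/-- HYPOTHESIS H'' — MODULUS CROSSING in the holomorphic stiffness coordinate (strictly weaker input
than `StiffTwoLevelStructure`: no analysis at the tie point, no two-level normal form, no non-constancy).
For every `K₀, L₀` there are `K ≥ K₀`, `L ≥ L₀`, a Berry parameter `|ε₂| ≤ 1/5`, a ball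
`ball a₀ ρ` whose closure lies in the admissible stiffness disc `‖a − 1‖ ≤ 1/4`, and a holomorphic
normaliser `lam` on the ball with `‖lam‖ ≥ m > 0` (intended: the Kato branch of the dominant charge-sector
eigenvalue of the slice transfer operator at `a₀`), such that
(dominance) `‖Z_M(a)/lam(a)^M − 1‖ ≤ 1/2` on a smaller ball `ball a₀ r₀` for all large `M`, and
(crossing) at ONE point `a₁ ∈ ball a₀ ρ` the partition function outgrows `lam` exponentially along a
subsequence: `e^{ηM} ‖lam a₁‖^M ≤ ‖Z_M(a₁)‖` frequently (intended: another sector's eigenvalue has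
modulus `> ‖lam a₁‖` and dominates there). -/
def StiffModulusCrossing : Prop :=
    ∀ (K₀ : ℝ) (L₀ : ℕ), ∃ K : ℝ, K₀ ≤ K ∧ ∃ (L : ℕ) (_ : NeZero L), L₀ ≤ L ∧
      ∃ ε₂ : ℝ, |ε₂| ≤ 1/5 ∧
      ∃ (a₀ : ℂ) (r₀ ρ : ℝ), 0 < r₀ ∧ r₀ < ρ ∧ closedBall a₀ ρ ⊆ closedBall (1 : ℂ) (1/4) ∧
        ∃ (lam : ℂ → ℂ) (m : ℝ), 0 < m ∧ DifferentiableOn ℂ lam (ball a₀ ρ) ∧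
          (∀ a ∈ ball a₀ ρ, m ≤ ‖lam a‖) ∧
          (∃ M₁ : ℕ, ∀ M : ℕ, M₁ ≤ M → ∀ (_ : NeZero M), ∀ a ∈ ball a₀ r₀,
            ‖partZ K (spatialTab + a • temporalCosTab + (Complex.I * ε₂) • temporalSinTab) L M
                / (lam a) ^ M - 1‖ ≤ 1/2) ∧
          ∃ a₁ ∈ ball a₀ ρ, ∃ η : ℝ, 0 < η ∧ ∀ M₁ : ℕ, ∃ M : ℕ, M₁ ≤ M ∧ ∃ (_ : NeZero M),
            Real.exp (η * M) * ‖lam a₁‖ ^ M ≤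
              ‖partZ K (spatialTab + a₁ • temporalCosTab + (Complex.I * ε₂) • temporalSinTab) L M‖

/-- NEGATIVE LEMMA MODULO H'': modulus crossing refutes the crux `BalabanIR.BirComplexStableXY`
(stmt-HubbardSuperconductivity-2080).  Proof: instantiate the crux at `r = 2, B = 128, c₀ = 1/24`; by
`stub_stiffTab_admissible` every stiffness in the ball is admissible, so conjunct 1 of the crux makes
`f_M(a) := Z_M(a)/lam(a)^M` ZERO-FREE and holomorphic on `ball a₀ ρ` for `M ≥ L`; the a-priori bound
`‖Z_M‖ ≤ e^{CM}` and `‖lam‖ ≥ m` give `‖f_M‖ ≤ e^{C'M}`; dominance gives `‖f_M − 1‖ ≤ 1/2` on `ball a₀ r₀`;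
the Literature lemma `Literature.Analysis.Complex.not_frequently_exp_mul_le_norm_of_zeroFree`
(Borel–Carathéodory + Hadamard three circles on a holomorphic logarithm: zero-free families cannot change
their exponential growth rate inside the ball) contradicts the crossing at `a₁`. [cite: BerahaKahaneWeiss1975, Theorem (necessity of (b))] -/
theorem BirComplexStableXY_false_of_StiffModulusCrossing :
    StiffModulusCrossing →
      ¬ Summit.HubbardSuperconductivity.HubbardSuperconductivity.Theses.BalabanIR.BirComplexStableXY := by
  intro hH h
  obtain ⟨K₀, L₀, hK⟩ := h 2 128 (1/24) le_rfl (by norm_num)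
  obtain ⟨K, hKK, L, hL, hL₀, ε₂, hε₂, a₀, r₀, ρ, hr₀, hr₀ρ, hdisc, lam, m, hm, hlam, hlamm,
    ⟨M₁, hdom⟩, a₁, ha₁, η, hη, hcross⟩ := hH K₀ L₀
  have hLpos : 0 < L := Nat.pos_of_ne_zero hL.ne
  -- abbreviation for the stiffness table
  set tab : ℂ → Table 2 := fun a =>
    spatialTab + a • temporalCosTab + (Complex.I * ε₂) • temporalSinTab with htab
  have hadm : ∀ a ∈ ball a₀ ρ, ‖a - 1‖ ≤ 1/4 := by
    intro a ha
    have : a ∈ closedBall (1 : ℂ) (1/4) := hdisc (ball_subset_closedBall ha)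
    simpa [mem_closedBall, dist_eq_norm] using this
  -- conjunct 1 of the crux: no zeros on the ball for M ≥ L
  have hZne : ∀ (M : ℕ) [NeZero M], L ≤ M → ∀ a ∈ ball a₀ ρ, partZ K (tab a) L M ≠ 0 := by
    intro M _ hLM a ha hZ
    obtain ⟨hU1, hN, hA, hC⟩ := stub_stiffTab_admissible a ε₂ (hadm a ha) hε₂
    have key := hK K hKK (tab a) hU1 hN hA hC L M hL₀ hLM
    dsimp only at key
    dsimp only [partZ, action, genF, sh, cube] at hZ
    exact key.1 hZ
  -- the normalised family
  set f : ℕ → ℂ → ℂ := fun M a =>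
    if hM : M = 0 then 1 else
      (haveI : NeZero M := ⟨hM⟩; partZ K (tab a) L M / (lam a) ^ M) with hf
  have hfM : ∀ (M : ℕ) [hM : NeZero M] (a : ℂ), f M a = partZ K (tab a) L M / (lam a) ^ M := by
    intro M hM a
    simp only [hf, dif_neg hM.ne]
  have hlam0 : ∀ a ∈ ball a₀ ρ, lam a ≠ 0 := fun a ha h0 => by
    have := hlamm a ha; rw [h0, norm_zero] at this; linarith
  -- (i) holomorphy
  have hdiff : ∀ᶠ M in atTop, DifferentiableOn ℂ (f M) (ball a₀ ρ) := by
    filter_upwards [eventually_ge_atTop 1] with M hM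
    haveI : NeZero M := ⟨by omega⟩
    have h1 : DifferentiableOn ℂ (fun a : ℂ => partZ K (tab a) L M) (ball a₀ ρ) :=
      (stub_partZ_stiff_differentiable K ε₂ L M).differentiableOn
    have h2 : DifferentiableOn ℂ (fun a : ℂ => (lam a) ^ M) (ball a₀ ρ) := hlam.pow M
    refine (h1.div h2 (fun a ha => pow_ne_zero M (hlam0 a ha))).congr ?_
    intro a _
    exact hfM M a
  -- (ii) no zeros
  have hne : ∀ᶠ M in atTop, ∀ z ∈ ball a₀ ρ, f M z ≠ 0 := by
    filter_upwards [eventually_ge_atTop L] with M hM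
    haveI : NeZero M := ⟨by omega⟩
    intro a ha
    rw [hfM M a]
    exact div_ne_zero (hZne M hM a ha) (pow_ne_zero M (hlam0 a ha))
  -- (iii) exponential a-priori bound
  set C₁ : ℝ := Fintype.card (TorusSite 2 L) * (128 * |K| + Real.log (2 * Real.pi)) with hC₁
  have hbd : ∀ᶠ M in atTop, ∀ z ∈ ball a₀ ρ, ‖f M z‖ ≤ Real.exp ((C₁ - Real.log m) * M) := by
    filter_upwards [eventually_ge_atTop 1] with M hM
    haveI : NeZero M := ⟨by omega⟩
    intro a ha
    rw [hfM M a, norm_div, norm_pow]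
    obtain ⟨_, _, hA, _⟩ := stub_stiffTab_admissible a ε₂ (hadm a ha) hε₂
    have hZ : ‖partZ K (tab a) L M‖ ≤ Real.exp (C₁ * M) := norm_partZ_le_exp K (tab a) hA L M
    have hlpos : 0 < ‖lam a‖ ^ M := pow_pos (lt_of_lt_of_le hm (hlamm a ha)) M
    rw [div_le_iff₀ hlpos]
    have hmM : Real.exp (Real.log m * M) ≤ ‖lam a‖ ^ M := by
      rw [mul_comm, Real.exp_nat_mul, Real.exp_log hm]
      exact pow_le_pow_left₀ hm.le (hlamm a ha) M
    calc ‖partZ K (tab a) L M‖ ≤ Real.exp (C₁ * M) := hZ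
      _ = Real.exp ((C₁ - Real.log m) * M) * Real.exp (Real.log m * M) := by
          rw [← Real.exp_add]; ring_nf
      _ ≤ Real.exp ((C₁ - Real.log m) * M) * ‖lam a‖ ^ M := by gcongr
  -- (iv) dominance on the small ball
  have hone : ∀ᶠ M in atTop, ∀ z ∈ ball a₀ r₀, ‖f M z - 1‖ ≤ 1/2 := by
    filter_upwards [eventually_ge_atTop (max M₁ 1)] with M hM
    haveI : NeZero M := ⟨by omega⟩
    intro a ha
    rw [hfM M a]
    exact hdom M (le_trans (le_max_left _ _) hM) inferInstance a ha
  -- the Literature lemma forbids exponential growth at a₁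
  have hmain := Literature.Analysis.Complex.not_frequently_exp_mul_le_norm_of_zeroFree hr₀ hr₀ρ
    hdiff hne hbd hone ha₁ hη
  apply hmain
  rw [Filter.frequently_atTop]
  intro M₂
  obtain ⟨M, hM, hMne, hineq⟩ := hcross M₂
  haveI : NeZero M := hMne
  refine ⟨M, hM, ?_⟩
  rw [hfM M a₁, norm_div, norm_pow]
  have hlpos : 0 < ‖lam a₁‖ ^ M := pow_pos (lt_of_lt_of_le hm (hlamm a₁ ha₁)) M
  rw [le_div_iff₀ hlpos]
  exact hineq

/-! ### H'' is implied by the two-level structure H -/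

/-- `StiffTwoLevelStructure → StiffModulusCrossing`: the modulus-crossing hypothesis is WEAKER than the
two-level structure of `BirComplexStableXYFalseOfStiffTwoLevelStructure.lean` (so the present negative lemma
subsumes that one).  Proof: by the open mapping theorem at the tie point `a₀` (`u` holomorphic, non-constant on
the ball, `‖u a₀‖ = 1`) there are, arbitrarily close to `a₀`, points `a'` with `‖u a'‖ < 1` and `a₁` with
`‖u a₁‖ > 1`; near `a'` the two-level bound gives dominance `‖Z_M/lam^M − 1‖ ≤ ‖u‖^M + Cq^M ≤ 1/2`, at `a₁`
it gives growth `‖Z_M/lam^M‖ ≥ ‖u a₁‖^M − 1 − Cq^M ≥ e^{ηM}`; `lam` is bounded below on a compact sub-ball.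
(Mathlib `AnalyticAt.eventually_constant_or_nhds_le_map_nhds`.) [folklore] -/
theorem stiffModulusCrossing_of_stiffTwoLevelStructure (h2 : StiffTwoLevelStructure) :
    StiffModulusCrossing := by
  intro K₀ L₀
  obtain ⟨K, hK, L, hL, hL₀, ε₂, hε₂, a₀, ρ, C, q, hρ, hq0, hq1, hdisc, u, lam, hu, hnorm, hnc, hlam,
    hlam0, M₁, happrox⟩ := h2 K₀ L₀
  refine ⟨K, hK, L, hL, hL₀, ε₂, hε₂, ?_⟩
  -- Step 1: open mapping at a₀
  have hua : AnalyticOnNhd ℂ u (ball a₀ ρ) := hu.analyticOnNhd isOpen_ball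
  have ha₀ : a₀ ∈ ball a₀ ρ := mem_ball_self hρ
  have hmap : 𝓝 (u a₀) ≤ map u (𝓝 a₀) := by
    refine (hua a₀ ha₀).eventually_constant_or_nhds_le_map_nhds.resolve_left ?_
    intro hconst
    obtain ⟨a, ha, hne⟩ := hnc
    have heq : Set.EqOn u (fun _ => u a₀) (ball a₀ ρ) :=
      hua.eqOn_of_preconnected_of_eventuallyEq analyticOnNhd_const
        (convex_ball a₀ ρ).isPreconnected ha₀ hconst
    exact hne (heq ha)
  -- Step 2: points with ‖u‖ < 1 and ‖u‖ > 1 inside ball a₀ δ, δ = ρ/4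
  set δ : ℝ := ρ / 4 with hδ
  have hδpos : 0 < δ := by positivity
  have himg : u '' ball a₀ δ ∈ 𝓝 (u a₀) := hmap (image_mem_map (ball_mem_nhds a₀ hδpos))
  obtain ⟨τ, hτ, hτsub⟩ := Metric.mem_nhds_iff.mp himg
  set t : ℝ := min τ 1 / 2 with ht
  have htpos : 0 < t := by positivity
  have htτ : t < τ := by
    have : min τ 1 ≤ τ := min_le_left _ _
    rw [ht]; linarith
  have ht1 : t < 1 := by
    have : min τ 1 ≤ 1 := min_le_right _ _
    rw [ht]; linarith
  have hmem : ∀ s : ℝ, |s - 1| ≤ t → ((s : ℂ) * u a₀) ∈ ball (u a₀) τ := by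
    intro s hs
    rw [mem_ball, dist_eq_norm]
    have e : (s : ℂ) * u a₀ - u a₀ = ((s - 1 : ℝ) : ℂ) * u a₀ := by push_cast; ring
    rw [e, norm_mul, Complex.norm_real, Real.norm_eq_abs, hnorm, mul_one]
    linarith
  obtain ⟨a', ha'δ, hua'⟩ := hτsub (hmem (1 - t) (by rw [show (1 - t - 1 : ℝ) = -t by ring, abs_neg,
    abs_of_pos htpos]))
  obtain ⟨a₁, ha₁δ, hua₁⟩ := hτsub (hmem (1 + t) (by rw [show (1 + t - 1 : ℝ) = t by ring,
    abs_of_pos htpos]))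
  have hnua' : ‖u a'‖ = 1 - t := by
    rw [hua', norm_mul, Complex.norm_real, Real.norm_eq_abs, hnorm, mul_one, abs_of_pos (by linarith)]
  have hnua₁ : ‖u a₁‖ = 1 + t := by
    rw [hua₁, norm_mul, Complex.norm_real, Real.norm_eq_abs, hnorm, mul_one, abs_of_pos (by linarith)]
  have ha'ρ : a' ∈ ball a₀ ρ := ball_subset_ball (by rw [hδ]; linarith) ha'δ
  have ha₁ρ : a₁ ∈ ball a₀ ρ := ball_subset_ball (by rw [hδ]; linarith) ha₁δ
  -- Step 3: the new ball: centre a', radius 2δ; it contains a₁ and sits inside ball a₀ ρ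
  have hsubball : ball a' (2 * δ) ⊆ ball a₀ ρ := by
    intro x hx
    rw [mem_ball] at hx ha'δ ⊢
    calc dist x a₀ ≤ dist x a' + dist a' a₀ := dist_triangle _ _ _
      _ < 2 * δ + δ := by linarith
      _ < ρ := by rw [hδ]; linarith
  have hsubclosed : closedBall a' (2 * δ) ⊆ ball a₀ ρ := by
    intro x hx
    rw [mem_closedBall] at hx; rw [mem_ball] at ha'δ ⊢
    calc dist x a₀ ≤ dist x a' + dist a' a₀ := dist_triangle _ _ _
      _ < 2 * δ + δ := by linarith
      _ < ρ := by rw [hδ]; linarith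
  have ha₁ball : a₁ ∈ ball a' (2 * δ) := by
    rw [mem_ball] at ha₁δ ha'δ ⊢
    calc dist a₁ a' ≤ dist a₁ a₀ + dist a₀ a' := dist_triangle _ _ _
      _ < δ + δ := by rw [dist_comm a₀ a']; linarith
      _ = 2 * δ := by ring
  -- lower bound for lam on the new ball (compactness of the closed ball)
  have hlamc : ContinuousOn (fun a => ‖lam a‖) (closedBall a' (2 * δ)) :=
    (hlam.continuousOn.mono hsubclosed).norm
  obtain ⟨xm, hxm, hmin⟩ := (isCompact_closedBall a' (2 * δ)).exists_isMinOn
    ⟨a', mem_closedBall_self (by positivity)⟩ hlamc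
  set m : ℝ := ‖lam xm‖ with hm
  have hmpos : 0 < m := norm_pos_iff.mpr (hlam0 xm (hsubclosed hxm))
  have hmle : ∀ a ∈ ball a' (2 * δ), m ≤ ‖lam a‖ := fun a ha =>
    hmin (ball_subset_closedBall ha)
  -- Step 4: dominance ball around a'
  have hucont : ContinuousAt u a' := (hu.differentiableAt (isOpen_ball.mem_nhds ha'ρ)).continuousAt
  obtain ⟨r₁, hr₁, hr₁sub⟩ : ∃ r₁ > 0, ∀ a ∈ ball a' r₁, ‖u a‖ ≤ 1 - t / 2 := by
    have hev : ∀ᶠ a in 𝓝 a', dist (u a) (u a') < t / 2 :=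
      (Metric.tendsto_nhds.mp hucont.tendsto) (t / 2) (by positivity)
    obtain ⟨r₁, hr₁, hsub⟩ := Metric.mem_nhds_iff.mp hev
    refine ⟨r₁, hr₁, fun a ha => ?_⟩
    have h1 : dist (u a) (u a') < t / 2 := hsub ha
    rw [dist_eq_norm] at h1
    calc ‖u a‖ = ‖(u a - u a') + u a'‖ := by ring_nf
      _ ≤ ‖u a - u a'‖ + ‖u a'‖ := norm_add_le _ _
      _ ≤ t / 2 + (1 - t) := by linarith
      _ = 1 - t / 2 := by ring
  set r₀ : ℝ := min r₁ δ with hr₀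
  have hr₀pos : 0 < r₀ := lt_min hr₁ hδpos
  have hr₀lt : r₀ < 2 * δ := lt_of_le_of_lt (min_le_right _ _) (by linarith)
  have hr₀sub : ball a' r₀ ⊆ ball a₀ ρ := (ball_subset_ball (le_of_lt hr₀lt)).trans hsubball
  -- eventual smallness of the two geometric terms
  set C' : ℝ := max C 0 with hC'
  have hC'nn : 0 ≤ C' := le_max_right _ _
  have hgeom1 : Tendsto (fun M : ℕ => (1 - t / 2) ^ M) atTop (𝓝 0) :=
    tendsto_pow_atTop_nhds_zero_of_lt_one (by linarith) (by linarith)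
  have hgeom2 : Tendsto (fun M : ℕ => C' * q ^ M) atTop (𝓝 0) := by
    simpa using (tendsto_pow_atTop_nhds_zero_of_lt_one hq0 hq1).const_mul C'
  have hev1 : ∀ᶠ M : ℕ in atTop, (1 - t / 2) ^ M ≤ 1/4 :=
    hgeom1.eventually (Iic_mem_nhds (by norm_num))
  have hev2 : ∀ᶠ M : ℕ in atTop, C' * q ^ M ≤ 1/4 :=
    hgeom2.eventually (Iic_mem_nhds (by norm_num))
  obtain ⟨M₂, hM₂⟩ := Filter.eventually_atTop.mp (hev1.and (hev2.and (eventually_ge_atTop M₁)))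
  have happrox' : ∀ (M : ℕ), M₁ ≤ M → ∀ (_ : NeZero M), ∀ a ∈ ball a₀ ρ,
      ‖partZ K (spatialTab + a • temporalCosTab + (Complex.I * ε₂) • temporalSinTab) L M / lam a ^ M
        - 1 - u a ^ M‖ ≤ C' * q ^ M := fun M hM _ a ha =>
    (happrox M hM inferInstance a ha).trans (by gcongr; exact le_max_left _ _)
  refine ⟨a', r₀, 2 * δ, hr₀pos, hr₀lt, hsubclosed.trans (ball_subset_closedBall.trans hdisc) |>.trans
    (subset_refl _), lam, m, hmpos, hlam.mono hsubball, hmle, ⟨M₂, ?_⟩, a₁, ha₁ball, ?_⟩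
  · -- dominance
    intro M hM _ a ha
    obtain ⟨h1, h2, h3⟩ := hM₂ M hM
    have hab : a ∈ ball a₀ ρ := hr₀sub ha
    have har₁ : a ∈ ball a' r₁ := ball_subset_ball (min_le_left _ _) ha
    have h4 := happrox' M h3 inferInstance a hab
    have h5 : ‖u a ^ M‖ ≤ 1/4 := by
      rw [norm_pow]
      calc ‖u a‖ ^ M ≤ (1 - t / 2) ^ M := pow_le_pow_left₀ (norm_nonneg _) (hr₁sub a har₁) M
        _ ≤ 1/4 := h1
    calc ‖partZ K (spatialTab + a • temporalCosTab + (Complex.I * ε₂) • temporalSinTab) L M / lam a ^ M - 1‖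
        = ‖(partZ K (spatialTab + a • temporalCosTab + (Complex.I * ε₂) • temporalSinTab) L M / lam a ^ M
            - 1 - u a ^ M) + u a ^ M‖ := by ring_nf
      _ ≤ C' * q ^ M + 1/4 := (norm_add_le _ _).trans (add_le_add h4 h5)
      _ ≤ 1/2 := by linarith
  · -- crossing at a₁ with η = log (1 + t/2)
    refine ⟨Real.log (1 + t / 2), Real.log_pos (by linarith), ?_⟩
    have hratio : Tendsto (fun M : ℕ => ((1 + t) / (1 + t / 2)) ^ M) atTop atTop :=
      tendsto_pow_atTop_atTop_of_one_lt ((one_lt_div (by positivity)).mpr (by linarith))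
    have hev3 : ∀ᶠ M : ℕ in atTop, 2 + C' ≤ ((1 + t) / (1 + t / 2)) ^ M :=
      hratio.eventually (Filter.eventually_ge_atTop _)
    intro M₃
    obtain ⟨M, hM⟩ := Filter.eventually_atTop.mp (hev3.and (eventually_ge_atTop (max (max M₁ M₃) 1)))
    obtain ⟨hM3, hMge⟩ := hM M le_rfl
    have hM₁M : M₁ ≤ M := le_trans (le_trans (le_max_left _ _) (le_max_left _ _)) hMge
    have hM₃M : M₃ ≤ M := le_trans (le_trans (le_max_right _ _) (le_max_left _ _)) hMge
    have hMne : NeZero M := ⟨by omega⟩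
    refine ⟨M, hM₃M, hMne, ?_⟩
    have h4 := happrox' M hM₁M hMne a₁ ha₁ρ
    set ZZ := partZ K (spatialTab + a₁ • temporalCosTab + (Complex.I * ε₂) • temporalSinTab) L M with hZZ
    have hl1 : 0 < ‖lam a₁‖ ^ M := pow_pos (norm_pos_iff.mpr (hlam0 a₁ ha₁ρ)) M
    -- lower bound on the normalised value
    have hlow : (1 + t / 2) ^ M ≤ ‖ZZ / lam a₁ ^ M‖ := by
      have e : u a₁ ^ M = ZZ / lam a₁ ^ M - (ZZ / lam a₁ ^ M - 1 - u a₁ ^ M) - 1 := by ring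
      have h5 : ‖u a₁ ^ M‖ ≤ ‖ZZ / lam a₁ ^ M‖ + C' * q ^ M + 1 := by
        calc ‖u a₁ ^ M‖ = ‖ZZ / lam a₁ ^ M - (ZZ / lam a₁ ^ M - 1 - u a₁ ^ M) - 1‖ := by rw [← e]
          _ ≤ ‖ZZ / lam a₁ ^ M - (ZZ / lam a₁ ^ M - 1 - u a₁ ^ M)‖ + ‖(1 : ℂ)‖ := norm_sub_le _ _
          _ ≤ ‖ZZ / lam a₁ ^ M‖ + ‖ZZ / lam a₁ ^ M - 1 - u a₁ ^ M‖ + ‖(1 : ℂ)‖ := by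
              gcongr; exact norm_sub_le _ _
          _ ≤ ‖ZZ / lam a₁ ^ M‖ + C' * q ^ M + 1 := by rw [norm_one]; gcongr
      rw [norm_pow, hnua₁] at h5
      have hq' : C' * q ^ M ≤ C' := by
        have : q ^ M ≤ 1 := pow_le_one₀ hq0 hq1.le
        nlinarith
      have hpowpos : 0 < (1 + t / 2) ^ M := pow_pos (by linarith) M
      have hkey : (2 + C') * (1 + t / 2) ^ M ≤ (1 + t) ^ M := by
        have := mul_le_mul_of_nonneg_right hM3 hpowpos.le
        rwa [div_pow, div_mul_cancel₀ _ hpowpos.ne'] at this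
      nlinarith [pow_le_pow_left₀ (by norm_num : (0:ℝ) ≤ 1) (by linarith : (1:ℝ) ≤ 1 + t / 2) M,
        one_pow (M := ℝ) M]
    have hexp : Real.exp (Real.log (1 + t / 2) * M) = (1 + t / 2) ^ M := by
      rw [mul_comm, Real.exp_nat_mul, Real.exp_log (by linarith)]
    rw [hexp]
    calc (1 + t / 2) ^ M * ‖lam a₁‖ ^ M ≤ ‖ZZ / lam a₁ ^ M‖ * ‖lam a₁‖ ^ M := by gcongr
      _ = ‖ZZ‖ := by rw [norm_div, norm_pow, div_mul_cancel₀ _ hl1.ne']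

/-- Hence the two-level negative lemma factors through the present one. [folklore] -/
theorem BirComplexStableXY_false_of_StiffTwoLevelStructure' (h2 : StiffTwoLevelStructure) :
    ¬ Summit.HubbardSuperconductivity.HubbardSuperconductivity.Theses.BalabanIR.BirComplexStableXY :=
  BirComplexStableXY_false_of_StiffModulusCrossing (stiffModulusCrossing_of_stiffTwoLevelStructure h2)

end

end Summit.HubbardSuperconductivity.BirComplexStableXYNegative
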